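/-
Copyright: statement-level skeleton of a published paper (lit-balaban cell, Phase-2 proof seat p25, gen 21). No proof
claims beyond what the kernel checks below.
-/
import Literature.MathematicalPhysics.QuantumFieldTheory.BalabanImbrieJaffe1984to88.BIJ88WalkIneq312RemainderBdry
import Literature.MathematicalPhysics.QuantumFieldTheory.BalabanImbrieJaffe1984to88.BIJ88WalkRemainderActivityNC312
import Literature.MathematicalPhysics.QuantumFieldTheory.BalabanImbrieJaffe1984to88.BIJ88WalkLocalTermCount312

/-!
# `BalabanImbrieJaffe1984to88.BIJ88WalkIneq312RemainderBdryNC` — T. Bałaban, J. Imbrie, A. Jaffe, *Effective action and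
cluster properties of the abelian Higgs model*, Commun. Math. Phys. **114** (1988) 257–315 [BalabanImbrieJaffe1988],
§5.14 p. 312 [PDF 56], verbatim (x2 render `lit-balaban-r16/renders/cmp114/original-p056-x2.png`): *"By performing
sufficiently many integrations by parts, we have arranged for enough small factors to beat these large factors in the
remainder terms (at least if X_{r′} is not at the boundary of Λ₁₂^{(k)}). Near the boundary we have potentially large
covariances C^{(k)}_{Λ₁₂^{(k)},loc} − C^{(k)}_{loc} or C^{(k)}_{Λ₁₂^{(k)},loc}(u_{k+1}) − C^{(k)}_{loc}(u_{k+1}), so we make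
use of the proximity to Λ₁₂^{(k)c} to provide the necessary convergence. These considerations lead to the following
estimate: |G_k(X)| ≤ c(F(X))(e^β(L^kε/ε₀)^{1/4−α})^{β′|X∖∪_cX_c|} × Π_{X_{σ_1} ⊂ X : dist(X_{σ_1}, Λ₁₂^{(k)c}) < r(e_k)}
[c(L^kε)^{−m(c)}e^{−m′(c)}]."* and p. 310 [PDF 54]: *"The others, localized in region X, have a factor of
e^{−cr(e_k)|X|}. We also consider as remainders any terms whose order in λ and e is greater than n̄."*
and (after the W₆′ estimate) *"(We allow adjustments in β, α, β′, keeping them small.)"* — **THE HEAD THEOREM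
OF ROW C2.Claim@312 IN THE CURRENCY `N` WITH THE LOCAL COUNT ABSTRACTED, AND GEN 21's `N`-HEAD RE-DERIVED AS ITS
INSTANCE** (p25 gen 21; file NC3, a MEMBER of the row, owner r16, referee ref-5; the head of record
`BIJ88WalkIneq312RemainderBdry.ineq312_remainder_bdry` (r16 v2.284, ref-5 g68 CONCUR), the chain D/E2/G/K and gen
21's N-files are NOT edited).

The head's constant `c_F(O) = K_χ·Λ_O·W_O^{Φ₀(O)}`, `W_O = max(1, ρ₀(Φ₀(O)+N₀))`, carries the locality of the
interaction through the UNIFORM letter `N₀` = the largest number of vertex legs one covariance piece couples to.  For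
print's localized walks that number grows with the walk, and for a split with a non-local piece it is the number of
ALL vertex legs — a volume; print's remedy is the walks' weight `e^{−cr(e_k)|X|}`.  The proof uses locality only
through the local weighted count `Σ_{t ∈ expand 0 O, t nondegenerate} Π pw ≤ C_O`, so here the head is re-threaded
with THAT as the hypothesis (`hcount`) and `c_F(O) = K_χ·Λ_O·C_O`: the uniform count
(`BIJ88WalkLocalTermCount312.expand_lsum_init_le`, §2: gen 21's `N`-head VERBATIM as an instance, hence the head of
record), gen 21's weighted count (`BIJ88WalkLocalTermCountW312.expand_lsum_init_le_W`, `ρ₀Φ₀ + ρ₁ ≤ W`) and any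
walk-length-weighted count all feed the same theorem.

statement-level skeleton of published theorems with citation tags; proofs where landed; nothing here is a claim
about the Yang–Mills mass gap

PDF held: `paper:balaban1988-cmp114-bij-abelian-higgs-effective-action` (journal page = PDF page + 256); p. 312 =
PDF 56 (`p0056.txt` L20–31), p. 310 = PDF 54.

CITATION HEADER (lean-in-tree rule).  lit-balaban cell (HOME `run/shared/lean/pub/lit-balaban/`), Phase 2, seat p25
gen 21; row **C2.Claim@312** of `HOME/lit-balaban-r16/ROWS-C2-part2.md` (owner r16, referee ref-5; head theorem of
record UNCHANGED; this file is a MEMBER — currency `N`, local count abstracted).  USED BY NAME, nothing restated: the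
typed leaf `BIJ88Sect5StatementsPart4.Ineq312` (r16), `BIJ88WalkIneq312Remainder.{remSys, phi0}`,
`BIJ88WalkIneq312RemainderBdry.prod_obs_mul_small_le_bdry`, `BIJ88WalkRemainderActivity312.{remAt, rloc, nfreeOf,
card_rloc}`, `BIJ88WalkTermCount312.pw`, `BIJ88WalkExpansionGeo311.NondegT`, `BIJ88WalkLocalTermCount312.expand_lsum_init_le`
(p25 gen 18–19), `BIJ88WalkRemainderActivityNC312.abs_remAt_div_le_NC` (p25 gen 21), the §5.13 model of record
(`prec`, `src`, `corner`, `fieldLaw`).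

## What is proved (0 `sorry`, standard axioms, no new `Prop` facts; theorems only, no definitions)

* §1 `ineq312_remainder_NC` (the sibling E2: all observables charged, `s^{#𝒳}` kept),
  **`ineq312_remainder_bdry_NC`** (THE HEAD'S STATEMENT in the currency `N` with `c_F(O) = K_χ·Λ_O·C_O` under
  `hcount : ∀ O, Σ_{t nondegenerate} Π pw ≤ C_O`; conclusion = the head's with `W_O^{Φ₀(O)}` replaced by `C_O`);
* §2 gen 21's `BIJ88WalkIneq312RemainderBdryN.ineq312_remainder_bdry_N` — EXACT statement — as the instance
  `C_O = W_O^{Φ₀(O)}` (an `example`; it in turn gives the head of record as `N = ‖·‖_∞`, file N3 §3).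
HONEST SCOPE — the head-question clauses (owner r16 (H1)–(H5), record v2.311 C1–C5) those of the head with two
remarks: currency `N ≥ 0`, `N 0 = 0` (gen 21) and the locality clause of C1 (`ρ₀`, `N₀`) replaced by the count letter
`C_O` (`hcount`), none discharged here; (H3) as printed, boundary-restricted product under `hbeat`; (H4) boundary
mechanism not modelled; (H5) pre-cluster-expansion.  NOT summit progress; NOT continuum; NOT Clay.  Imports
`BIJ88WalkIneq312RemainderBdry`, `BIJ88WalkRemainderActivityNC312`, `BIJ88WalkLocalTermCount312`; modifies nothing.
-/

noncomputable section

namespace Literature.MathematicalPhysics.QuantumFieldTheory.BalabanImbrieJaffe1984to88.BIJ88WalkIneq312RemainderBdryNC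

open Classical MeasureTheory Matrix Finset
open scoped BigOperators
open Literature.MathematicalPhysics.QuantumFieldTheory.Balaban1983to89
open B2Eq228Conditioning (weight source)
open BIJ88PolymerRep5134 (corner)
open BIJ88PolymerRep5134Gauss (prec src)
open BIJ88SlotMomentsGauss308 (fieldLaw)
open BIJ88VertexIbp311 (vexp)
open BIJ88WickDerivatives305 (dlist)
open BIJ88VertexComponents311 (maxArity)
open BIJ88WalkRun311 BIJ88WalkExpansion311 BIJ88WalkExpansionGeo311 BIJ88WalkLabelPartition312
  BIJ88WalkTermCount312 BIJ88WalkLocalTermCount312 BIJ88WalkRemainderActivity312 BIJ88WalkIneq312Remainder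
  BIJ88WalkIneq312RemainderBdry BIJ88WalkRemainderActivityNC312

variable {ι : Type} [Fintype ι] {κ : Type} [LinearOrder κ] {P : Type} [Fintype P] {β : Type} [DecidableEq β]
variable {α I : Type} [Fintype α] [DecidableEq α] [Fintype I] [DecidableEq I]
  {blk : α → I} {Δ : Matrix α α ℝ} {ℱ : α → ℝ} {W : Finset I}

omit [Fintype ι] [LinearOrder κ] [Fintype P] in
/-- The local weighted count is a sum of nonnegative terms (bookkeeping). [folklore] -/
private theorem lsum_nonneg {S : Type} {ρ : P → ℝ} (hρ : ∀ p, 0 ≤ ρ p) (E : Multiset (WTerm S κ ι P)) :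
    0 ≤ (E.map fun t => if NondegT t then ((t.consts + t.groups).map (pw ρ)).prod else 0).sum :=
  Multiset.sum_nonneg fun x hx => by
    obtain ⟨t, -, rfl⟩ := Multiset.mem_map.1 hx
    split_ifs
    · exact Multiset.prod_nonneg fun y hy => by
        obtain ⟨g, -, rfl⟩ := Multiset.mem_map.1 hy
        exact Multiset.prod_nonneg fun z hz => by obtain ⟨p, -, rfl⟩ := Multiset.mem_map.1 hz; exact hρ p
    · exact le_rfl

/-! ## §1  The leaf `Ineq312` for the located remainder families, currency `N`, abstract local count -/

/-- **THE SIBLING E2 IN THE CURRENCY `N`, ABSTRACT LOCAL COUNT** (all observables charged, `s^{#𝒳}` kept in `c_F`):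
under the hypotheses of `BIJ88WalkRemainderActivityNC312.abs_remAt_div_le_NC` for every `O` (`hcount : ∀ O, … ≤ C_O`),
`Ineq312 remSys (remAt(O,𝒳)/Z) (K_χ·Λ_O·C_O·s^{#𝒳}) (Π_{j∈O} B_ℓ^{|obs j|}) (Σ_r #(X_r ∖ obs cubes)) θ 1`.
[cite: BalabanImbrieJaffe1988, §5.14 p.312 (estimate preceding (5.14.5))] -/
theorem ineq312_remainder_NC (hPD : (prec blk Δ W (corner ℝ W)).PosDef)
    {N : ({x : α // blk x ∈ W} → ℝ) → ℝ} (hN0 : ∀ z, 0 ≤ N z) (hNz : N 0 = 0)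
    {Cov : P → Matrix {x : α // blk x ∈ W} {x : α // blk x ∈ W} ℝ} {trig : P → Bool} {c : ι → ℝ}
    {legs : ι → List ({x : α // blk x ∈ W} → ℝ)} {obs : κ → List ({x : α // blk x ∈ W} → ℝ)} {M : ℕ}
    {χ : ({x : α // blk x ∈ W} → ℝ) → ℝ} {oc : κ → Finset β} {vc : ι → Finset β} {reg : P → Finset β}
    {Dir : Set ({x : α // blk x ∈ W} → ℝ)} {B' ρ : P → ℝ} {cV : ι → ℝ} {Bl θ θv θw ηχ Kχ : ℝ} {Λ C : Finset κ → ℝ}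
    (hθ0 : 0 < θ) (hθ1 : θ ≤ 1) (hBl : 1 ≤ Bl) (hB0 : ∀ p, 0 ≤ B' p) (hρ : ∀ p, 0 ≤ ρ p) (hcV0 : ∀ m, 0 ≤ cV m)
    (hη0 : 0 ≤ ηχ) (hη1 : ηχ ≤ 1) (hθv : 0 < θv) (hθv1 : θv ≤ 1) (hθw : 0 < θw) (hθw1 : θw ≤ 1)
    (hB : ∀ p, ∀ u ∈ Dir, ∀ w ∈ Dir, |(Cov p *ᵥ u) ⬝ᵥ w| ≤ B' p * ρ p)
    (hBf : ∀ p, ∀ u ∈ Dir, |(Cov p *ᵥ u) ⬝ᵥ src blk ℱ W| ≤ B' p * ρ p)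
    (hBzN : ∀ p, ∀ u ∈ Dir, N (Cov p *ᵥ u) ≤ B' p * ρ p)
    (hcV : ∀ m, |c m| ≤ cV m) (hobs : ∀ j, ∀ w ∈ obs j, w ∈ Dir) (hlegs : ∀ m, ∀ w ∈ legs m, w ∈ Dir)
    (hloc : ∀ p, trig p = false → B' p ≤ Bl ∧ reg p = ∅) (hwalk : ∀ p, trig p = true → B' p ≤ θw * θ ^ (reg p).card)
    (hvert : ∀ m, cV m * Bl ^ (legs m).length ≤ θv * θ ^ (vc m).card)
    (hcount : ∀ O : Finset κ, ((expand Cov trig (src blk ℱ W) c legs obs M 0 O).map fun t =>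
      if NondegT t then ((t.consts + t.groups).map (pw ρ)).prod else 0).sum ≤ C O)
    (hKχ : 0 ≤ Kχ) (hΛ : ∀ O, 0 ≤ Λ O)
    (hE : ∀ O : Finset κ, ∀ t ∈ expand Cov trig (src blk ℱ W) c legs obs M 0 O, t.consts = 0 →
      |∫ φ, ((t.groups.map fun h => (h.pend : Multiset _)).sum.map fun w => φ ⬝ᵥ w).prod
          * (dlist t.dirs χ φ * vexp c legs φ) ∂(fieldLaw blk Δ ℱ W)|
        ≤ Kχ * (t.dirs.map fun z => ηχ * N z).prod * Λ O) :
    BIJ88Sect5StatementsPart4.Ineq312 (remSys κ β)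
      (fun OX => remAt (prec blk Δ W (corner ℝ W)) Cov trig (src blk ℱ W) c legs obs M χ oc vc reg [] 0 OX.1 OX.2
        / ∫ φ, weight (prec blk Δ W (corner ℝ W)) φ * source (src blk ℱ W) φ)
      (fun OX => Kχ * Λ OX.1 * C OX.1 * (max ηχ (max (θv ^ M) θw)) ^ Multiset.card OX.2)
      (fun OX => ∏ j ∈ OX.1, Bl ^ (obs j).length)
      (fun OX => nfreeOf oc OX.2) θ 1 := by
  intro OX
  obtain ⟨O, 𝒳⟩ := OX
  have hnf : θ ^ ((1 : ℝ) * (nfreeOf oc 𝒳 : ℕ)) = θ ^ nfreeOf oc 𝒳 := by rw [one_mul, Real.rpow_natCast]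
  simp only []
  rw [hnf]
  have h := abs_remAt_div_le_NC (oc := oc) (vc := vc) (reg := reg) (χ := χ) hPD hN0 hNz hθ0 hθ1 hBl hB0 hρ hcV0 hη0
    hη1 hθv hθv1 hθw hθw1 hB hBf hBzN hcV hobs hlegs hloc hwalk hvert O (hcount O) hKχ (hΛ O) (hE O) 𝒳
  calc _ ≤ Kχ * Λ O * (C O * ∏ j ∈ O, Bl ^ (obs j).length)
        * (θ ^ nfreeOf oc 𝒳 * (max ηχ (max (θv ^ M) θw)) ^ Multiset.card 𝒳) := h
    _ = _ := by ring

/-- **THE HEAD THEOREM OF ROW C2.Claim@312 IN THE CURRENCY `N`, LOCAL COUNT ABSTRACTED**: the hypotheses of gen 21's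
`BIJ88WalkIneq312RemainderBdryN.ineq312_remainder_bdry_N` with the locality letters (`ρ₀`, `N₀`) replaced by the
local weighted count they produce, `hcount : ∀ O, Σ_{t ∈ expand 0 O, t nondegenerate} Π_X pw X ≤ C_O`; conclusion the
head's with `c_F(O) = K_χ·Λ_O·C_O`:
`Ineq312 remSys (remAt(O,𝒳)/Z) (K_χ·Λ_O·C_O) (Π_{j∈O, j∈bdry} B_ℓ^{|obs j|}) (Σ_r #(X_r ∖ obs cubes)) θ 1` — print's
`|G_k(X)| ≤ c(F(X))(e^β(L^kε/ε₀)^{1/4−α})^{β′|X∖∪_cX_c|} × Π_{X_{σ_1} ⊂ X : dist(X_{σ_1}, Λ₁₂^{(k)c}) < r(e_k)}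
[c(L^kε)^{−m(c)}e^{−m′(c)}]` for the located remainder families, pre-cluster-expansion, for ANY admissible count.
[cite: BalabanImbrieJaffe1988, §5.14 p.312 (estimate preceding (5.14.5))] -/
theorem ineq312_remainder_bdry_NC (hPD : (prec blk Δ W (corner ℝ W)).PosDef)
    {N : ({x : α // blk x ∈ W} → ℝ) → ℝ} (hN0 : ∀ z, 0 ≤ N z) (hNz : N 0 = 0)
    {Cov : P → Matrix {x : α // blk x ∈ W} {x : α // blk x ∈ W} ℝ} {trig : P → Bool} {c : ι → ℝ}
    {legs : ι → List ({x : α // blk x ∈ W} → ℝ)} {obs : κ → List ({x : α // blk x ∈ W} → ℝ)} {M : ℕ}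
    {χ : ({x : α // blk x ∈ W} → ℝ) → ℝ} {oc : κ → Finset β} {vc : ι → Finset β} {reg : P → Finset β}
    {Dir : Set ({x : α // blk x ∈ W} → ℝ)} {B' ρ : P → ℝ} {cV : ι → ℝ} {Bl θ θv θw ηχ Kχ : ℝ} {Λ C : Finset κ → ℝ}
    (hθ0 : 0 < θ) (hθ1 : θ ≤ 1) (hBl : 1 ≤ Bl) (hB0 : ∀ p, 0 ≤ B' p) (hρ : ∀ p, 0 ≤ ρ p) (hcV0 : ∀ m, 0 ≤ cV m)
    (hη0 : 0 ≤ ηχ) (hη1 : ηχ ≤ 1) (hθv : 0 < θv) (hθv1 : θv ≤ 1) (hθw : 0 < θw) (hθw1 : θw ≤ 1)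
    (hB : ∀ p, ∀ u ∈ Dir, ∀ w ∈ Dir, |(Cov p *ᵥ u) ⬝ᵥ w| ≤ B' p * ρ p)
    (hBf : ∀ p, ∀ u ∈ Dir, |(Cov p *ᵥ u) ⬝ᵥ src blk ℱ W| ≤ B' p * ρ p)
    (hBzN : ∀ p, ∀ u ∈ Dir, N (Cov p *ᵥ u) ≤ B' p * ρ p)
    (hcV : ∀ m, |c m| ≤ cV m) (hobs : ∀ j, ∀ w ∈ obs j, w ∈ Dir) (hlegs : ∀ m, ∀ w ∈ legs m, w ∈ Dir)
    (hloc : ∀ p, trig p = false → B' p ≤ Bl ∧ reg p = ∅) (hwalk : ∀ p, trig p = true → B' p ≤ θw * θ ^ (reg p).card)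
    (hvert : ∀ m, cV m * Bl ^ (legs m).length ≤ θv * θ ^ (vc m).card)
    (hcount : ∀ O : Finset κ, ((expand Cov trig (src blk ℱ W) c legs obs M 0 O).map fun t =>
      if NondegT t then ((t.consts + t.groups).map (pw ρ)).prod else 0).sum ≤ C O)
    (hKχ : 0 ≤ Kχ) (hΛ : ∀ O, 0 ≤ Λ O)
    (hE : ∀ O : Finset κ, ∀ t ∈ expand Cov trig (src blk ℱ W) c legs obs M 0 O, t.consts = 0 →
      |∫ φ, ((t.groups.map fun h => (h.pend : Multiset _)).sum.map fun w => φ ⬝ᵥ w).prod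
          * (dlist t.dirs χ φ * vexp c legs φ) ∂(fieldLaw blk Δ ℱ W)|
        ≤ Kχ * (t.dirs.map fun z => ηχ * N z).prod * Λ O)
    (bdry : Finset κ)
    (hbeat : ∀ O : Finset κ, ∀ t ∈ expand Cov trig (src blk ℱ W) c legs obs M 0 O, t.consts = 0 → ∀ X ∈ t.groups,
      max ηχ (max (θv ^ M) θw) * ∏ j ∈ X.lab.filter (fun j => j ∉ bdry), Bl ^ (obs j).length ≤ 1) :
    BIJ88Sect5StatementsPart4.Ineq312 (remSys κ β)
      (fun OX => remAt (prec blk Δ W (corner ℝ W)) Cov trig (src blk ℱ W) c legs obs M χ oc vc reg [] 0 OX.1 OX.2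
        / ∫ φ, weight (prec blk Δ W (corner ℝ W)) φ * source (src blk ℱ W) φ)
      (fun OX => Kχ * Λ OX.1 * C OX.1)
      (fun OX => ∏ j ∈ OX.1.filter (fun j => j ∈ bdry), Bl ^ (obs j).length)
      (fun OX => nfreeOf oc OX.2) θ 1 := by
  intro OX
  obtain ⟨O, 𝒳⟩ := OX
  have hnf : θ ^ ((1 : ℝ) * (nfreeOf oc 𝒳 : ℕ)) = θ ^ nfreeOf oc 𝒳 := by rw [one_mul, Real.rpow_natCast]
  simp only []
  rw [hnf]
  have hBl0 : 0 ≤ Bl := zero_le_one.trans hBl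
  set s := max ηχ (max (θv ^ M) θw) with hs
  have hs0 : 0 ≤ s := hη0.trans (le_max_left _ _)
  have hCO : 0 ≤ C O := (lsum_nonneg hρ _).trans (hcount O)
  have hC0 : 0 ≤ Kχ * Λ O * C O * θ ^ nfreeOf oc 𝒳 :=
    mul_nonneg (mul_nonneg (mul_nonneg hKχ (hΛ O)) hCO) (pow_nonneg hθ0.le _)
  have hP0 : 0 ≤ ∏ j ∈ O.filter (fun j => j ∈ bdry), Bl ^ (obs j).length := prod_nonneg fun j _ => pow_nonneg hBl0 _
  by_cases hex : ∃ t ∈ expand Cov trig (src blk ℱ W) c legs obs M 0 O, t.consts = 0 ∧ rloc oc vc reg t = 𝒳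
  · obtain ⟨t, ht, hc, h𝒳⟩ := hex
    have h := abs_remAt_div_le_NC (oc := oc) (vc := vc) (reg := reg) (χ := χ) hPD hN0 hNz hθ0 hθ1 hBl hB0 hρ hcV0 hη0
      hη1 hθv hθv1 hθw hθw1 hB hBf hBzN hcV hobs hlegs hloc hwalk hvert O (hcount O) hKχ (hΛ O) (hE O) 𝒳
    have hcard : Multiset.card 𝒳 = Multiset.card t.groups := by rw [← h𝒳, card_rloc]
    have hbeat' := prod_obs_mul_small_le_bdry hBl hs0 bdry ht hc (hbeat O t ht hc)
    rw [← hcard] at hbeat'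
    calc _ ≤ Kχ * Λ O * (C O * ∏ j ∈ O, Bl ^ (obs j).length) * (θ ^ nfreeOf oc 𝒳 * s ^ Multiset.card 𝒳) := h
      _ = Kχ * Λ O * C O * θ ^ nfreeOf oc 𝒳 * (s ^ Multiset.card 𝒳 * ∏ j ∈ O, Bl ^ (obs j).length) := by ring
      _ ≤ Kχ * Λ O * C O * θ ^ nfreeOf oc 𝒳
          * ∏ j ∈ O.filter (fun j => j ∈ bdry), Bl ^ (obs j).length := mul_le_mul_of_nonneg_left hbeat' hC0
      _ = _ := by ring
  · -- no no-block term is located at `𝒳`: the localized remainder part vanishes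
    have h0 : remAt (prec blk Δ W (corner ℝ W)) Cov trig (src blk ℱ W) c legs obs M χ oc vc reg [] 0 O 𝒳 = 0 := by
      rw [remAt]
      refine Multiset.sum_eq_zero fun x hx => ?_
      obtain ⟨t, ht, rfl⟩ := Multiset.mem_map.1 hx
      exact if_neg fun h => hex ⟨t, ht, h⟩
    rw [h0, zero_div, abs_zero]
    exact mul_nonneg hC0 hP0

/-! ## §2  Gen 21's `N`-head (hence the head of record) re-derived as the instance `C_O = W_O^{Φ₀(O)}` -/

/-- **THE UNIFORM COUNT IS AN INSTANCE**: the EXACT statement of gen 21's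
`BIJ88WalkIneq312RemainderBdryN.ineq312_remainder_bdry_N` (uniform locality `N₀`, `W_O = max(1, ρ₀(Φ₀(O)+N₀))`),
obtained from `ineq312_remainder_bdry_NC` with `C O := W_O^{Φ₀(O)}` and the count
`BIJ88WalkLocalTermCount312.expand_lsum_init_le` — kernel-checked as an `example` (the gate's `dedup.landed` rule:
a landed statement is not re-declared under a second name). [cite: BalabanImbrieJaffe1988, §5.14 p.312] -/
example (hPD : (prec blk Δ W (corner ℝ W)).PosDef)
    {N : ({x : α // blk x ∈ W} → ℝ) → ℝ} (hN0 : ∀ z, 0 ≤ N z) (hNz : N 0 = 0)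
    {Cov : P → Matrix {x : α // blk x ∈ W} {x : α // blk x ∈ W} ℝ} {trig : P → Bool} {c : ι → ℝ}
    {legs : ι → List ({x : α // blk x ∈ W} → ℝ)} {obs : κ → List ({x : α // blk x ∈ W} → ℝ)} {M : ℕ}
    {χ : ({x : α // blk x ∈ W} → ℝ) → ℝ} {oc : κ → Finset β} {vc : ι → Finset β} {reg : P → Finset β}
    {Dir : Set ({x : α // blk x ∈ W} → ℝ)} {B' ρ : P → ℝ} {cV : ι → ℝ} {Bl θ θv θw ηχ ρ₀ Kχ : ℝ} {Λ : Finset κ → ℝ}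
    {N₀ : ℕ}
    (hθ0 : 0 < θ) (hθ1 : θ ≤ 1) (hBl : 1 ≤ Bl) (hB0 : ∀ p, 0 ≤ B' p) (hρ : ∀ p, 0 ≤ ρ p) (hcV0 : ∀ m, 0 ≤ cV m)
    (hη0 : 0 ≤ ηχ) (hη1 : ηχ ≤ 1) (hθv : 0 < θv) (hθv1 : θv ≤ 1) (hθw : 0 < θw) (hθw1 : θw ≤ 1)
    (hB : ∀ p, ∀ u ∈ Dir, ∀ w ∈ Dir, |(Cov p *ᵥ u) ⬝ᵥ w| ≤ B' p * ρ p)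
    (hBf : ∀ p, ∀ u ∈ Dir, |(Cov p *ᵥ u) ⬝ᵥ src blk ℱ W| ≤ B' p * ρ p)
    (hBzN : ∀ p, ∀ u ∈ Dir, N (Cov p *ᵥ u) ≤ B' p * ρ p)
    (hcV : ∀ m, |c m| ≤ cV m) (hobs : ∀ j, ∀ w ∈ obs j, w ∈ Dir) (hlegs : ∀ m, ∀ w ∈ legs m, w ∈ Dir)
    (hloc : ∀ p, trig p = false → B' p ≤ Bl ∧ reg p = ∅) (hwalk : ∀ p, trig p = true → B' p ≤ θw * θ ^ (reg p).card)
    (hvert : ∀ m, cV m * Bl ^ (legs m).length ≤ θv * θ ^ (vc m).card) (hρ₀0 : 0 ≤ ρ₀)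
    (hρ₀ : ∀ u ∈ Dir, (∑ p ∈ univ.filter (fun p => Cov p *ᵥ u ≠ 0), ρ p) ≤ ρ₀)
    (hN₀ : ∀ p, ∀ u ∈ Dir,
      (∑ m, ((range (legs m).length).filter fun j => (Cov p *ᵥ u) ⬝ᵥ (legs m).getD j 0 ≠ 0).card) ≤ N₀)
    (hKχ : 0 ≤ Kχ) (hΛ : ∀ O, 0 ≤ Λ O)
    (hE : ∀ O : Finset κ, ∀ t ∈ expand Cov trig (src blk ℱ W) c legs obs M 0 O, t.consts = 0 →
      |∫ φ, ((t.groups.map fun h => (h.pend : Multiset _)).sum.map fun w => φ ⬝ᵥ w).prod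
          * (dlist t.dirs χ φ * vexp c legs φ) ∂(fieldLaw blk Δ ℱ W)|
        ≤ Kχ * (t.dirs.map fun z => ηχ * N z).prod * Λ O)
    (bdry : Finset κ)
    (hbeat : ∀ O : Finset κ, ∀ t ∈ expand Cov trig (src blk ℱ W) c legs obs M 0 O, t.consts = 0 → ∀ X ∈ t.groups,
      max ηχ (max (θv ^ M) θw) * ∏ j ∈ X.lab.filter (fun j => j ∉ bdry), Bl ^ (obs j).length ≤ 1) :
    BIJ88Sect5StatementsPart4.Ineq312 (remSys κ β)
      (fun OX => remAt (prec blk Δ W (corner ℝ W)) Cov trig (src blk ℱ W) c legs obs M χ oc vc reg [] 0 OX.1 OX.2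
        / ∫ φ, weight (prec blk Δ W (corner ℝ W)) φ * source (src blk ℱ W) φ)
      (fun OX => Kχ * Λ OX.1 * (max 1 (ρ₀ * ((phi0 legs obs M OX.1 + N₀ : ℕ) : ℝ))) ^ phi0 legs obs M OX.1)
      (fun OX => ∏ j ∈ OX.1.filter (fun j => j ∈ bdry), Bl ^ (obs j).length)
      (fun OX => nfreeOf oc OX.2) θ 1 :=
  ineq312_remainder_bdry_NC (oc := oc) (vc := vc) (reg := reg) (χ := χ)
    (C := fun O => (max 1 (ρ₀ * ((phi0 legs obs M O + N₀ : ℕ) : ℝ))) ^ phi0 legs obs M O) hPD hN0 hNz hθ0 hθ1 hBl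
    hB0 hρ hcV0 hη0 hη1 hθv hθv1 hθw hθw1 hB hBf hBzN hcV hobs hlegs hloc hwalk hvert
    (fun O => expand_lsum_init_le (trig := trig) (f := src blk ℱ W) (c := c) hobs hlegs hρ hρ₀0 hρ₀ hN₀ O
      (le_max_left _ _) (le_max_right _ _))
    hKχ hΛ hE bdry hbeat

end Literature.MathematicalPhysics.QuantumFieldTheory.BalabanImbrieJaffe1984to88.BIJ88WalkIneq312RemainderBdryNC

end
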